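import Literature.Algebra.Homology.CartanCriterion
import HarnessLib

/-!
# The Čech complex of a one-arrow family: the section model

For a single arrow `g : V → U` in a category with finite wide pullbacks — a family of arrows
indexed by a one-element type `ι` — the Čech complex `Č•({g}, P) = Hom(ℤ[N({g})]_•, P)` of an
abelian presheaf `P` (`CechNerve.lean`, `CartanCriterion.lean`) is identified with the complex of
sections of `P` over the iterated fibre products `V ×_U ⋯ ×_U V` (`cechProd g m`, `m + 1` factors)
with differential the alternating sum of the restrictions along the face maps
(`cechδ`, `cechD`): a cochain is determined by its value on the universal simplex over
`V ×_U ⋯ ×_U V` (`cechSection`, `cechSectionCochain`, mutually inverse), compatibly with the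
differentials (`cechSection_d`, `cechSectionCochain_cechD`), so that exactness in positive degrees
can be checked on sections (`cechCochainComplex_exactAt_succ_iff_sections`). This is the form in
which the Čech complexes of `ν*F` on a presented pro-étale cover are computed as filtered colimits
of étale Čech complexes in the proof of Bhatt–Scholze Cor. 5.1.6
(`Literature/AlgebraicGeometry/Motives/EtaleToProetCechCover.lean`).

## References

* J. S. Milne, *Étale cohomology* (2025 reissue): III §2, the complex `C•(𝒰, P)` with
  `Cⁿ = ∏ P(U_{i₀…iₙ})` (held copy PDF pp. 104–109). [Milne2025]

## Design notes

* `cechD` is stated for presheaves with coefficients in any universe (it does not involve the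
  nerve); the comparison with the nerve model needs coefficients `Ab.{max w v}` as in
  `CechNerve.lean`. The index type `ι` is a `Unique` type (for the pro-étale application
  `PUnit`), made explicit in `cechSection`/`cechSectionCochain`.
* Only theorems and real definitions; no named facts (D-0026).
* Mathlib searched: `SheafCohomology/Cech.lean` (`cechComplex` of a family of objects via finite
  products, no comparison with nerves or cohomology). Nothing restated.
-/

universe w' w v u

open CategoryTheory Opposite Limits Abelian Simplicial

namespace Literature.Algebra.Homology

/-! ### The section model of the Čech complex of a one-arrow family

For a single arrow `g : V → U` (a family indexed by a one-element type `ι`) in a category with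
finite wide pullbacks, Čech `m`-cochains of an abelian presheaf `P` are the sections of `P` over
`V ×_U ⋯ ×_U V` (`m + 1` factors), and the Čech differential is the alternating sum of the
restrictions along the face maps. -/

section OneArrow

variable {C : Type u} [Category.{v} C] [HasFiniteWidePullbacks C] {ι : Type w} [Unique ι]
  {U V : C} (g : V ⟶ U)

/-- `V ×_U ⋯ ×_U V` (`m + 1` factors): the wide pullback of the one-arrow family `{g}` (at any
index map, all being equal to the constant one). [folklore] -/
noncomputable abbrev cechProd (m : ℕ) : C := widePullback U (fun _ : Fin (m + 1) => V) (fun _ => g)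

omit [Unique ι] in
/-- The wide pullbacks of the one-arrow family are the iterated fibre products `V ×_U ⋯ ×_U V`
(by `rfl`). [folklore] -/
lemma cechWidePullback_oneArrow {m : ℕ} (kk : Fin (m + 1) → ι) :
    cechWidePullback (V := fun _ : ι => V) (fun _ => g) kk = cechProd g m := rfl

/-- The `i`-th face map `V^{m+2} → V^{m+1}` (omit the `i`-th factor). [folklore] -/
noncomputable def cechδ (m : ℕ) (i : Fin (m + 2)) : cechProd g (m + 1) ⟶ cechProd g m :=
  WidePullback.lift (WidePullback.base _) (fun a => WidePullback.π _ (Fin.succAbove i a))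
    (fun _ => WidePullback.π_arrow _ _)

/-- A face map followed by a projection. [folklore] -/
@[reassoc]
lemma cechδ_π (m : ℕ) (i : Fin (m + 2)) (a : Fin (m + 1)) :
    cechδ g m i ≫ WidePullback.π (fun _ => g) a = WidePullback.π (fun _ => g) (Fin.succAbove i a) :=
  WidePullback.lift_π _ _ _ _ _

/-- A face map followed by the base map. [folklore] -/
@[reassoc]
lemma cechδ_base (m : ℕ) (i : Fin (m + 2)) :
    cechδ g m i ≫ WidePullback.base (fun _ => g) = WidePullback.base (fun _ => g) :=
  WidePullback.lift_base _ _ _ _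

section Sections

universe w₀

variable (P : Cᵒᵖ ⥤ AddCommGrpCat.{w₀})

omit [Unique ι]

/-- **The Čech differential on sections** over the iterated fibre products:
`D s = Σᵢ (-1)ⁱ δᵢ^* s`. [folklore] -/
noncomputable def cechD (m : ℕ) (s : P.obj (op (cechProd g m))) : P.obj (op (cechProd g (m + 1))) :=
  ∑ i : Fin (m + 2), ((-1 : ℤ) ^ (i : ℕ)) • P.map (cechδ g m i).op s

/-- `cechD` is additive. [folklore] -/
lemma cechD_add (m : ℕ) (s s' : P.obj (op (cechProd g m))) :
    cechD g P m (s + s') = cechD g P m s + cechD g P m s' := by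
  simp only [cechD, map_add, smul_add, Finset.sum_add_distrib]

/-- `cechD 0 = 0`. [folklore] -/
lemma cechD_zero (m : ℕ) : cechD g P m 0 = 0 := by
  simp only [cechD, map_zero, smul_zero, Finset.sum_const_zero]

variable {P}

/-- `cechD` is natural in the presheaf. [folklore] -/
lemma cechD_map {P' : Cᵒᵖ ⥤ AddCommGrpCat.{w₀}} (η : P ⟶ P') (m : ℕ)
    (s : P.obj (op (cechProd g m))) :
    cechD g P' m (η.app _ s) = η.app _ (cechD g P m s) := by
  simp only [cechD, map_sum, map_zsmul]
  refine Finset.sum_congr rfl fun i _ => ?_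
  rw [NatTrans.naturality_apply]

end Sections

variable {P : Cᵒᵖ ⥤ AddCommGrpCat.{max w v}}

variable (ι) in
/-- The classifying morphism `T → V ×_U ⋯ ×_U V` of a simplex of the one-arrow family.
[folklore] -/
noncomputable abbrev classify {m : ℕ} {T : C} (x : (cechSimplex (V := fun _ : ι => V) (fun _ => g) m).obj (op T)) :
    T ⟶ cechProd g m :=
  cechSimplexLift (V := fun _ : ι => V) (fun _ => g) (fun _ => default) x
    (fun _ => Subsingleton.elim _ _)

/-- The classifying morphism followed by a projection is the corresponding entry. [folklore] -/
lemma classify_π {m : ℕ} {T : C} (x : (cechSimplex (V := fun _ : ι => V) (fun _ => g) m).obj (op T))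
    (a : Fin (m + 1)) : classify ι g x ≫ WidePullback.π (fun _ => g) a = (x.1 a).2 := by
  unfold classify cechSimplexLift
  rw [WidePullback.lift_π]
  simp only [eqToHom_refl, Category.comp_id]

/-- The classifying morphism followed by the base map. [folklore] -/
lemma classify_base {m : ℕ} {T : C} (x : (cechSimplex (V := fun _ : ι => V) (fun _ => g) m).obj (op T)) :
    classify ι g x ≫ WidePullback.base (fun _ => g) = (x.1 0).2 ≫ g :=
  WidePullback.lift_base _ _ _ _

/-- The classifying morphism of a face is the classifying morphism followed by the face map.
[folklore] -/
lemma classify_cechFace {m : ℕ} {T : C} (i : Fin (m + 2))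
    (x : (cechSimplex (V := fun _ : ι => V) (fun _ => g) (m + 1)).obj (op T)) :
    classify ι g (cechFace (fun _ => g) m i (op T) x) = classify ι g x ≫ cechδ g m i := by
  apply WidePullback.hom_ext
  · intro a
    rw [Category.assoc, cechδ_π, classify_π, classify_π]
    exact congrArg (fun s : CechIndex (V := fun _ : ι => V) T => (s.2 : T ⟶ V))
      (cechFace_val (fun _ => g) m i (op T) x a)
  · rw [Category.assoc, cechδ_base, classify_base, classify_base]
    have h0 := congrArg (fun s : CechIndex (V := fun _ : ι => V) T => (s.2 : T ⟶ V))
      (cechFace_val (fun _ => g) m i (op T) x 0)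
    rw [h0]
    exact x.2 _ _

/-- The classifying morphism of the universal simplex is the identity. [folklore] -/
lemma classify_cechUniversalSimplex (m : ℕ) :
    classify ι g (cechUniversalSimplex (V := fun _ : ι => V) (fun _ => g)
      (fun _ : Fin (m + 1) => default)) = 𝟙 _ := by
  apply WidePullback.hom_ext
  · intro a
    rw [classify_π, Category.id_comp]
    rfl
  · rw [classify_base, Category.id_comp]
    exact WidePullback.π_arrow _ _

variable (P)

/-- Naturality of `x ↦ (classify x)^* s`. [folklore] -/
lemma map_classify_aux {m : ℕ} (s : P.obj (op (cechProd g m))) {T T' : Cᵒᵖ} (τ : T ⟶ T')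
    (x : (cechSimplex (V := fun _ : ι => V) (fun _ => g) m).obj T) :
    P.map τ (P.map (classify ι g (T := T.unop) x).op s) =
      P.map (classify ι g (T := T'.unop) ((cechSimplex (V := fun _ : ι => V) (fun _ => g) m).map τ x)).op s := by
  change (P.map _ ≫ P.map τ) s = _
  rw [← P.map_comp]
  change P.map (τ.unop ≫ classify ι g x).op s = _
  rw [← cechSimplexLift_map]
  rfl

variable (ι) in
/-- **The cochain of a section**: `s ∈ P(V ×_U ⋯ ×_U V)` defines the Čech `m`-cochain
`x ↦ (classify x)^* s`. [folklore] -/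
noncomputable def cechSectionCochain (m : ℕ) (s : P.obj (op (cechProd g m))) :
    (cechNerveComplex (V := fun _ : ι => V) (fun _ => g)).X m ⟶ P :=
  cechLift (fun _ => g) (fun T x => P.map (classify ι g (T := T.unop) x).op s)
    (fun τ x => map_classify_aux g P s τ x)

/-- Values of the cochain of a section. [folklore] -/
@[simp] lemma cechEval_cechSectionCochain (m : ℕ) (s : P.obj (op (cechProd g m))) (T : Cᵒᵖ)
    (x : (cechSimplex (V := fun _ : ι => V) (fun _ => g) m).obj T) :
    cechEval (fun _ => g) (cechSectionCochain ι g P m s) T x = P.map (classify ι g (T := T.unop) x).op s :=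
  cechEval_cechLift _ _ (fun τ x => map_classify_aux g P s τ x) T x

variable (ι) in
/-- **The section of a cochain**: its value on the universal simplex. [folklore] -/
noncomputable def cechSection (m : ℕ) (φ : (cechNerveComplex (V := fun _ : ι => V) (fun _ => g)).X m ⟶ P) :
    P.obj (op (cechProd g m)) :=
  cechEval (fun _ => g) φ _ (cechUniversalSimplex (V := fun _ : ι => V) (fun _ => g)
    (fun _ : Fin (m + 1) => default))

/-- `cechSection` is additive. [folklore] -/
lemma cechSection_add (m : ℕ) (φ φ' : (cechNerveComplex (V := fun _ : ι => V) (fun _ => g)).X m ⟶ P) :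
    cechSection ι g P m (φ + φ') = cechSection ι g P m φ + cechSection ι g P m φ' := rfl

/-- `cechSection 0 = 0`. [folklore] -/
lemma cechSection_zero (m : ℕ) :
    cechSection ι g P m (0 : (cechNerveComplex (V := fun _ : ι => V) (fun _ => g)).X m ⟶ P) = 0 := rfl

/-- `section ∘ cochain = id`. [folklore] -/
lemma cechSection_cechSectionCochain (m : ℕ) (s : P.obj (op (cechProd g m))) :
    cechSection ι g P m (cechSectionCochain ι g P m s) = s := by
  unfold cechSection
  rw [cechEval_cechSectionCochain, classify_cechUniversalSimplex, op_id, P.map_id]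
  rfl

/-- `cochain ∘ section = id`: a cochain is determined by its value on the universal simplex.
[folklore] -/
lemma cechSectionCochain_cechSection (m : ℕ)
    (φ : (cechNerveComplex (V := fun _ : ι => V) (fun _ => g)).X m ⟶ P) :
    cechSectionCochain ι g P m (cechSection ι g P m φ) = φ := by
  apply cech_hom_ext
  intro T x
  rw [cechEval_cechSectionCochain]
  unfold cechSection
  rw [map_cechEval]
  congr 1
  exact cechSimplex_map_cechSimplexLift (fun _ => g) _ (T := T.unop) x _

/-- **The Čech differential in the section model**: the section of `dφ` is `D` of the section
of `φ`. [folklore] -/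
theorem cechSection_d (m : ℕ) (φ : (cechNerveComplex (V := fun _ : ι => V) (fun _ => g)).X m ⟶ P) :
    cechSection ι g P (m + 1) ((cechCochainComplex (fun _ => g) P).d m (m + 1) φ) =
      cechD g P m (cechSection ι g P m φ) := by
  conv_lhs => rw [← cechSectionCochain_cechSection g P m φ]
  unfold cechSection cechD
  rw [cechEval_d]
  refine Finset.sum_congr rfl fun i _ => ?_
  rw [cechEval_cechSectionCochain, classify_cechFace, classify_cechUniversalSimplex,
    Category.id_comp]

/-- The cochain of `D s` is `d` of the cochain of `s`. [folklore] -/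
theorem cechSectionCochain_cechD (m : ℕ) (s : P.obj (op (cechProd g m))) :
    cechSectionCochain ι g P (m + 1) (cechD g P m s) =
      (cechCochainComplex (fun _ => g) P).d m (m + 1) (cechSectionCochain ι g P m s) := by
  rw [← cechSectionCochain_cechSection g P (m + 1) ((cechCochainComplex _ P).d m (m + 1) _),
    cechSection_d, cechSection_cechSectionCochain]

/-- **Čech exactness in the section model.** The Čech complex `Č•({g}, P)` is exact in degree
`m + 1` iff every `s ∈ P(V^{m+2})` with `D s = 0` is `D t` for some `t ∈ P(V^{m+1})`. [folklore] -/
theorem cechCochainComplex_exactAt_succ_iff_sections (m : ℕ) :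
    (cechCochainComplex (V := fun _ : ι => V) (fun _ => g) P).ExactAt (m + 1) ↔
      ∀ s : P.obj (op (cechProd g (m + 1))), cechD g P (m + 1) s = 0 →
        ∃ t : P.obj (op (cechProd g m)), cechD g P m t = s := by
  rw [(cechCochainComplex (fun _ => g) P).exactAt_iff' m (m + 1) (m + 2) (by simp) (by simp),
    ShortComplex.ab_exact_iff]
  constructor
  · intro h s hs
    obtain ⟨ψ, hψ⟩ := h (cechSectionCochain ι g P (m + 1) s) (by
      change (cechCochainComplex (fun _ => g) P).d (m + 1) (m + 2) _ = 0
      rw [← cechSectionCochain_cechD, hs]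
      apply cech_hom_ext
      intro T x
      rw [cechEval_cechSectionCochain, map_zero]
      rfl)
    refine ⟨cechSection ι g P m ψ, ?_⟩
    change (cechCochainComplex (fun _ => g) P).d m (m + 1) ψ = _ at hψ
    rw [← cechSection_d, hψ, cechSection_cechSectionCochain]
  · intro h φ hφ
    change (cechCochainComplex (fun _ => g) P).d (m + 1) (m + 2) φ = 0 at hφ
    obtain ⟨t, ht⟩ := h (cechSection ι g P (m + 1) φ) (by
      rw [← cechSection_d, hφ]
      rfl)
    refine ⟨cechSectionCochain ι g P m t, ?_⟩
    change (cechCochainComplex (fun _ => g) P).d m (m + 1) _ = φ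
    rw [← cechSectionCochain_cechD, ht, cechSectionCochain_cechSection]

end OneArrow

end Literature.Algebra.Homology
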